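/-
Copyright (c) 2026 the pub-hodgecm-mathlib formalisation cell (harness21).  Prover seat hodgecm-mathlib-R90-C10-p05 (g2) = LEAD of line «B_pos» (R90-TF SLAB section S1 «Ch10-local»,
base R90-C10; h413 = `stmt-HodgeConjecture-24833`): (8⁺b) THE (S-RT) PAYER HEAD of U4Keys :182 in BRANCH B at positive depth at a TAMELY RAMIFIED place, MODULO THE TWO LETTERS
`HRa` ∕ `HRb` (dealt BY NAME, ruling R-S1-30 of the S1 dealer R90-C10-plan (g3), 2026-09-05T02:36:07Z): the mirror of ★ p864624 `R90S1KeysThmTwoPosDepthBranchBInertAllLeafOfRecord`,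
assembled from the leaf ★ p864247 (8) (R90-C10-p01 (g3)), its entries-from-cut-offs ★ p864652 (8⁺a) (R90-C10-p01 (g3)), the ramified master integral ★ (6c) (R90-C10-p06 (g3)), the cut
shells ★ (B) and the indicator dictionary ★ FILE B (R90-C10-p02 (g3)), the ramified cell witnesses ★ (B-10)(2) (R90-C10-p08 (g2)).  2026-09-05.
-/
import Summits.HodgeConjecture.HodgeConjecture.Theorems.R90S1KeysThmTwoPosDepthBranchBRamifiedTameLeaf   -- ★ p864247 (8): `exists_eta_of_reducible_posDepth_normTrivial_ramifiedTame_of_pairEntries` (the leaf modulo `HEram`); brings ★ `cells_witness_kZero_ram`, ★ `norm_apply_norm_uniformizer_lt_one`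
import Summits.HodgeConjecture.HodgeConjecture.Theorems.R90S1BposRamPairEntriesOfShells              -- ★ p864652 (8⁺a): `HEram_body_of_cutoffs` (the ∃-body of `HEram` from the two cut-off values); brings ★ `integrableOn_F₀_S_ge`
import Summits.HodgeConjecture.HodgeConjecture.Theorems.R90S1BposPairIntegrandIndicatorsTwoDepth     -- ★ p864496 FILE B (R90-C10-p02 (g3)): the four indicator identities `toFun_…_eq_indicator_…`, `cutoff_subset_setOf_one_le_v`
import Summits.HodgeConjecture.HodgeConjecture.Theorems.R90S1BposRamMasterIntegral                  -- ★ p864460 (6c) (R90-C10-p06 (g3)): `setIntegral_cutoff_eq_of_even_odd_shells` (the cut-off value from the shell values)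
import Summits.HodgeConjecture.HodgeConjecture.Theorems.R90S1BposRamCutoffShells                    -- ★ (B) (R90-C10-p08 (g2)): `measurableSet_shell_cut` (the cut shells are Borel, any place)
import HarnessLib

/-!
# R90-TF S1 «Ch10-local» ∕ K2 E3 «U4Keys» :182 — BRANCH B AT POSITIVE DEPTH, TAMELY RAMIFIED PLACE: THE (S-RT) HEAD MODULO THE TWO SHELL LETTERS `HRa` ∕ `HRb` (8⁺b)
# «`v` non-split, ramified in `L`, `|2|_{w′} = 1`, `χ₁` continuous, non-unitary, contracting, of positive depth, `χ₁(u·σu) = 1` on units, `i(χ₁, 1)` reducible ⟹ `χ₁ = η·‖·‖^{1∕2}`»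
# [Keys1984 §3, §7 Thm (2) (d); Casselman1980 §3; Roche1998 §3–§4; Rogawski1990 §12.2 (1)–(2)]

Cell `pub/hodgecm-mathlib`, crux H413 = `stmt-HodgeConjecture-24833`, route of record `HCCMUnconditional` (no route verbs); R90-TF section S1 (organ U4Keys ED. 10, socket (S-RT)
:224–:238; junction socket A2′ = :217).  THEOREMS ONLY (no `def`, no `instance`, no `notation`, no named-fact hypothesis, no `sorry`); lane `--supports stmt-HodgeConjecture-24833
--as helper`, count-neutral.  NOT THE PAYER of (S-RT): the head below carries TWO OPEN LETTERS over the head's own binders `L v χ₁` — **`HRa`** (sub-branch (R-a), `χ₁ = 1` on the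
σ-fixed units of valuation one: EVERY cut shell `Sh_j ∩ cut ν` of the Casselman integrand `F₀` vanishes; payer of record (a′)-R `R90S1BposRamShellsVanishOfRecord`, R90-C10-p02 (g3),
over ★ (a′)-1 p864421 + (a′)-2) and **`HRb`** (sub-branch (R-b), witness `hFε`: the even shells vanish, the odd ones are `C·X^{κ+1}` with `C²·X = (q^ν·μ B(ν,0))²·(q−1)²·(q^{2ν+1})⁻¹`
= the CONCLUSION BYTES of ★ p864649 (6d-R) `R90S1BposRamShellLawOfRecord.shellLaw_of_values` (R90-C10-p03 (g2)), which pays it the day its four Φ-value letters (G2)(G4)+PART 3 are ★: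
the shim is ONE `fun … hFε => shellLaw_of_values …` term).  K2E3 consumes (S-RT) only through the ≤ 20-line UNLETTERED shim once both letters are ★-discharged (R-S1-30).
THE LINE («d0B programme at Roche's two-depth group `J_e`, `e = (ν, 0; ν, 1)`, `2ν = cond χ₁` EVEN at a tame ramified place», p08 (g2) census 3c8eaa3bd4b223c1): reducible ⟹ `det M = 0`
for the normalised `(J_e, θ)`-type basis (★ (8) §1: ★ (B-1a), ★ (B-1′), ★ (B-8), ★ (B-2b″)+(B-10)(2), ★ (B-0)); the four entries of `M` are the two box volumes and the two cut-off
integrals `∫_{C(ν, j₀)} F₀ dμ`, `j₀ ∈ {1, 0}` (★ FILE B indicators, ★ (8⁺a)); a cut-off integral is the geometric sum of its cut shells (★ (6c)): under (R-a) all shells vanish (`HRa`)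
⟹ `det ≠ 0`, absurd; under (R-b) the parity law (`HRb`) gives the Γ-shapes with `Γ²X = (q−1)²(q^{2ν+1})⁻¹` ⟹ ★ (7) ⟹ `χ₁ = η·‖·‖^{1∕2}` (★ (7a)).
* §1 **`KeysThmTwoPosDepthBranchBRamifiedTameLeafOfRecord.HEram_of_layers`** — the letter `HEram` of ★ (8) (its binder type VERBATIM) from `HRa`, `HRb`.
* §2 **`exists_eta_of_reducible_posDepth_normTrivial_ramifiedTame`** — the (S-RT) head: socket binders `hns hrf h2 χ₁ h₁ hnu hcontr hram hpos hB` (typ2 fa479885beeb3078; `hram`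
  carried for the socket's ∀-text, unused), then `HRa HRb` (AFTER `hB`, BEFORE `hred`; typ2 (g4) «=» 02:39:15Z), then `hred` ⊢ disjunct 2 of :182.  One term over ★ (8) §2.
HONEST LABEL.  HC_CM is proved only modulo the 7 printed citations (2 remaining named inputs: hLiu418 = `stmt-HodgeConjecture-24832`, h413 = `stmt-HodgeConjecture-24833`) until rung 0
closes; this file is a head MODULO two letters — (S-RT) is paid only when `HRa` ∕ `HRb` are ★-discharged AND K2E3's edition is WRITTEN + BUILT; :182 ∕ A2′ OPEN; REL ≠ ★ ≠ BUILT;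
count-neutral; no printed citation is discharged.

## References
* [Keys1984] D. Keys, *Principal series representations of special unitary groups over local fields*, Compositio Math. 51 (1984), §3, §7 Theorem (2) (b)–(d) p. 126.
* [Casselman1980] W. Casselman, *The unramified principal series of p-adic groups I*, Compositio Math. 40 (1980), §3.
* [Roche1998] A. Roche, *Types and Hecke algebras for principal series representations of split reductive p-adic groups*, Ann. Sci. ÉNS (4) 31 (1998), §3–§4.
* [Rogawski1990] J. D. Rogawski, *Automorphic Representations of Unitary Groups in Three Variables*, Ann. of Math. Stud. 123 (1990), §12.2 (1)–(2) p. 173.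
-/

set_option autoImplicit false
set_option linter.dupNamespace false  -- the mandated namespace has the single-problem summit's repeated segment (`HodgeConjecture.HodgeConjecture`)

noncomputable section

open NumberField IsDedekindDomain MeasureTheory
open scoped Matrix MatrixGroups WithZero Valued NNReal
open Literature.NumberTheory Literature.NumberTheory.Automorphic Literature.NumberTheory.Automorphic.UnitaryGroup
open Literature.NumberTheory.Rogawski1990

namespace Summit.HodgeConjecture.HodgeConjecture.R90.S1

open Summit.HodgeConjecture.HodgeConjecture.Cruxes.H413
open Summit.HodgeConjecture.HodgeConjecture.Cruxes.H413.K2E3DepthZeroIwahoriCharacterCM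

variable (L : Type) [Field L] [NumberField L] [IsCMField L] (v : HeightOneSpectrum (𝓞 ↥(maximalRealSubfield L)))

/-! ## §1 The letter `HEram` of ★ (8) from the two shell letters `HRa` ∕ `HRb` -/

namespace KeysThmTwoPosDepthBranchBRamifiedTameLeafOfRecord

open Classical in
set_option maxHeartbeats 4000000 in
set_option synthInstance.maxHeartbeats 400000 in
-- the `SmoothInd` carrier on `U(Φ₃)(L⁺_v)` and the GL-coercion chains of the frame (class of ★ (8) ∕ ★ (8⁺a))
/-- **`HEram` FROM THE SHELL LETTERS.**  `v` non-split (`hns`); `χ₁ : (L ⊗ L⁺_v)ˣ → ℂˣ` continuous (`h₁`) and contracting (`hcontr`).  GIVEN the two shell letters over every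
ramified tame `w ∣ v` (`e(w|v) ≠ 1`, `|2|_w = 1`), uniformiser `ϖ`, uniformiser unit `Π` (`X := χ₁(σΠ·Π)`), conductor datum `(m ≥ 1, ν + ν = m + 1, hcond, u₁)` and Borel Haar measure
`μ` of `N(L⁺_v)` — **`HRa`**: if `χ₁ = 1` on the σ-fixed units of valuation one then every cut shell `Sh_j ∩ cut ν = {|z|_w = eʲ ∧ |x|_w ≤ e^{j−ν}}` of
`F₀(n) = χ₁((σẑ)⁻¹)·‖ẑ‖⁻¹` (`z = n₀₂`) integrates to `0` (even `j ≥ j₀`, and odd `j = 2κ+1`); **`HRb`**: if some σ-fixed unit `a` of valuation one has `χ₁ a ≠ 1` then the even shells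
vanish and the odd ones are `C·X^{κ+1}` with `C²·X = (q^ν·μ B(ν,0))²·((q−1)²·(q^{2ν+1})⁻¹)` (`q = N𝔓_w`, `B(ν,0) = {|z|_w ≤ |ϖ|⁰ ∧ |x|_w ≤ |ϖ|^ν}`) — THEN the letter `HEram` of ★ (8)
`exists_eta_of_reducible_posDepth_normTrivial_ramifiedTame_of_pairEntries` holds (its binder type VERBATIM): on every (G3) frame at `J_e`, `e = (ν, 0; ν, 1)`, for every normalised
`(J_e, θ)`-type basis `(f₁, f_w)` the four cell integrals are integrable, the volumes are `(q^ν)⁻¹·V` (`V = q^ν·μ B(ν,0) ≠ 0`) and the big-cell entries are the (R-a) zeros or the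
(R-b) Γ-shapes.  Proof: the shell family `R` and its ramified witnesses ★ `cells_witness_kZero_ram`; the four integrands as indicators (★ FILE B at `r₁ = r₂ = ν`); the cut shells
are Borel (★ (B)); `F₀` is integrable on `C(ν, j₀) ⊆ {|z| ≥ 1}` (★); `|X| < 1` (★); by cases on the (R-b) witness: the cut-off values `C·X·(1−X)⁻¹` by ★ (6c) from `HRb` (resp. with
`C := 0` from `HRa`), then ★ (8⁺a) `HEram_body_of_cutoffs` with `hCdich := Or.inr ⟨hFε, hC2⟩` (resp. `Or.inl rfl`). [cite: Keys1984, §3, §7 Theorem (2) (d) p. 126]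
[cite: Casselman1980, §3] [cite: Roche1998, §3–§4] [cite: Rogawski1990, §12.2 (1)–(2) p. 173] -/
theorem HEram_of_layers
    (hns : ∀ w' : PlacesOver L v, IsCMField.complexConj L • w'.1 = w'.1)
    (χ₁ : (LocalRing L v)ˣ →* ℂˣ) (h₁ : Continuous fun x => ((χ₁ x : ℂˣ) : ℂ))
    (hcontr : ∀ x : (LocalRing L v)ˣ, unitModulusChar (LocalRing L v) x < 1 → ‖((χ₁ x : ℂˣ) : ℂ)‖ < 1)
    (HRa : ∀ (w : PlacesOver L v) (hw : IsCMField.complexConj L • w.1 = w.1)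
      (_he : v.asIdeal.ramificationIdx' w.1.asIdeal ≠ 1) (_h2w : Valued.v (2 : w.1.adicCompletion L) = 1)
      {ϖ : w.1.adicCompletion L} (_hϖ : Valued.v ϖ = WithZero.exp (-1 : ℤ))
      (piU : (LocalRing L v)ˣ) (_hpiU : ∀ w' : PlacesOver L v, Valued.v ((piU : LocalRing L v) w') = WithZero.exp (-1 : ℤ))
      {m ν : ℕ} (_hm : 1 ≤ m) (_hνν : ν + ν = m + 1)
      (_hcond : ∀ u : (LocalRing L v)ˣ, (∀ w' : PlacesOver L v, Valued.v (((u : LocalRing L v) w') - 1) ≤ Valued.v ϖ ^ (m + 1)) → χ₁ u = 1)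
      (u₁ : (LocalRing L v)ˣ) (_hu₁ : ∀ w' : PlacesOver L v, Valued.v (((u₁ : LocalRing L v) w') - 1) ≤ Valued.v ϖ ^ m) (_hχu₁ : χ₁ u₁ ≠ 1)
      [MeasurableSpace ↥(cmBorelTriple L 3 v).N] [BorelSpace ↥(cmBorelTriple L 3 v).N] (μ : Measure ↥(cmBorelTriple L 3 v).N) [μ.IsHaarMeasure],
      (∀ a : (LocalRing L v)ˣ, Units.map (conjLocal L (IsCMField.complexConj L) v : LocalRing L v →* LocalRing L v) a = a →
          (∀ w' : PlacesOver L v, Valued.v ((a : LocalRing L v) w') = 1) → χ₁ a = 1) →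
    (∀ j₀ j : ℕ, j₀ ≤ j → Even j → ∫ n in {m : ↥(cmBorelTriple L 3 v).N |
        Valued.v (((((m : ↥(unitaryGroupOfForm (conjLocal L (IsCMField.complexConj L) v) (cmLocalForm L 3 v))) : GL (Fin 3) (LocalRing L v)) : Matrix (Fin 3) (Fin 3) (LocalRing L v)) 0 2) w) = WithZero.exp (j : ℤ) ∧
        Valued.v (((((m : ↥(unitaryGroupOfForm (conjLocal L (IsCMField.complexConj L) v) (cmLocalForm L 3 v))) : GL (Fin 3) (LocalRing L v)) : Matrix (Fin 3) (Fin 3) (LocalRing L v)) 0 1) w) ≤ WithZero.exp ((j : ℤ) - ν)},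
        (fun n : ↥(cmBorelTriple L 3 v).N =>
          if h : IsUnit ((((n : ↥(unitaryGroupOfForm (conjLocal L (IsCMField.complexConj L) v) (cmLocalForm L 3 v))) : GL (Fin 3) (LocalRing L v)) : Matrix (Fin 3) (Fin 3) (LocalRing L v)) 0 2) then
            ((((χ₁ (Units.map ((conjLocal L (IsCMField.complexConj L) v) : LocalRing L v →* LocalRing L v) h.unit))⁻¹ : ℂˣ) : ℂ) *
              ((((unitModulusChar (LocalRing L v) h.unit)⁻¹ : ℝ≥0) : ℝ) : ℂ))
          else 0) n ∂μ = 0) ∧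
      (∀ j κ : ℕ, j = 2 * κ + 1 → ∫ n in {m : ↥(cmBorelTriple L 3 v).N |
          Valued.v (((((m : ↥(unitaryGroupOfForm (conjLocal L (IsCMField.complexConj L) v) (cmLocalForm L 3 v))) : GL (Fin 3) (LocalRing L v)) : Matrix (Fin 3) (Fin 3) (LocalRing L v)) 0 2) w) = WithZero.exp (j : ℤ) ∧
          Valued.v (((((m : ↥(unitaryGroupOfForm (conjLocal L (IsCMField.complexConj L) v) (cmLocalForm L 3 v))) : GL (Fin 3) (LocalRing L v)) : Matrix (Fin 3) (Fin 3) (LocalRing L v)) 0 1) w) ≤ WithZero.exp ((j : ℤ) - ν)},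
          (fun n : ↥(cmBorelTriple L 3 v).N =>
            if h : IsUnit ((((n : ↥(unitaryGroupOfForm (conjLocal L (IsCMField.complexConj L) v) (cmLocalForm L 3 v))) : GL (Fin 3) (LocalRing L v)) : Matrix (Fin 3) (Fin 3) (LocalRing L v)) 0 2) then
              ((((χ₁ (Units.map ((conjLocal L (IsCMField.complexConj L) v) : LocalRing L v →* LocalRing L v) h.unit))⁻¹ : ℂˣ) : ℂ) *
                ((((unitModulusChar (LocalRing L v) h.unit)⁻¹ : ℝ≥0) : ℝ) : ℂ))
            else 0) n ∂μ = 0))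
    (HRb : ∀ (w : PlacesOver L v) (hw : IsCMField.complexConj L • w.1 = w.1)
      (_he : v.asIdeal.ramificationIdx' w.1.asIdeal ≠ 1) (_h2w : Valued.v (2 : w.1.adicCompletion L) = 1)
      {ϖ : w.1.adicCompletion L} (_hϖ : Valued.v ϖ = WithZero.exp (-1 : ℤ))
      (piU : (LocalRing L v)ˣ) (_hpiU : ∀ w' : PlacesOver L v, Valued.v ((piU : LocalRing L v) w') = WithZero.exp (-1 : ℤ))
      {m ν : ℕ} (_hm : 1 ≤ m) (_hνν : ν + ν = m + 1)
      (_hcond : ∀ u : (LocalRing L v)ˣ, (∀ w' : PlacesOver L v, Valued.v (((u : LocalRing L v) w') - 1) ≤ Valued.v ϖ ^ (m + 1)) → χ₁ u = 1)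
      (u₁ : (LocalRing L v)ˣ) (_hu₁ : ∀ w' : PlacesOver L v, Valued.v (((u₁ : LocalRing L v) w') - 1) ≤ Valued.v ϖ ^ m) (_hχu₁ : χ₁ u₁ ≠ 1)
      [MeasurableSpace ↥(cmBorelTriple L 3 v).N] [BorelSpace ↥(cmBorelTriple L 3 v).N] (μ : Measure ↥(cmBorelTriple L 3 v).N) [μ.IsHaarMeasure],
      (∃ a : (LocalRing L v)ˣ, Units.map (conjLocal L (IsCMField.complexConj L) v : LocalRing L v →* LocalRing L v) a = a ∧
          (∀ w' : PlacesOver L v, Valued.v ((a : LocalRing L v) w') = 1) ∧ χ₁ a ≠ 1) →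
    (∀ j₀ j : ℕ, j₀ ≤ j → Even j → ∫ n in {m : ↥(cmBorelTriple L 3 v).N |
        Valued.v (((((m : ↥(unitaryGroupOfForm (conjLocal L (IsCMField.complexConj L) v) (cmLocalForm L 3 v))) : GL (Fin 3) (LocalRing L v)) : Matrix (Fin 3) (Fin 3) (LocalRing L v)) 0 2) w) = WithZero.exp (j : ℤ) ∧
        Valued.v (((((m : ↥(unitaryGroupOfForm (conjLocal L (IsCMField.complexConj L) v) (cmLocalForm L 3 v))) : GL (Fin 3) (LocalRing L v)) : Matrix (Fin 3) (Fin 3) (LocalRing L v)) 0 1) w) ≤ WithZero.exp ((j : ℤ) - ν)},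
        (fun n : ↥(cmBorelTriple L 3 v).N =>
          if h : IsUnit ((((n : ↥(unitaryGroupOfForm (conjLocal L (IsCMField.complexConj L) v) (cmLocalForm L 3 v))) : GL (Fin 3) (LocalRing L v)) : Matrix (Fin 3) (Fin 3) (LocalRing L v)) 0 2) then
            ((((χ₁ (Units.map ((conjLocal L (IsCMField.complexConj L) v) : LocalRing L v →* LocalRing L v) h.unit))⁻¹ : ℂˣ) : ℂ) *
              ((((unitModulusChar (LocalRing L v) h.unit)⁻¹ : ℝ≥0) : ℝ) : ℂ))
          else 0) n ∂μ = 0) ∧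
    ∃ C : ℂ,
      (∀ j κ : ℕ, j = 2 * κ + 1 → ∫ n in {m : ↥(cmBorelTriple L 3 v).N |
          Valued.v (((((m : ↥(unitaryGroupOfForm (conjLocal L (IsCMField.complexConj L) v) (cmLocalForm L 3 v))) : GL (Fin 3) (LocalRing L v)) : Matrix (Fin 3) (Fin 3) (LocalRing L v)) 0 2) w) = WithZero.exp (j : ℤ) ∧
          Valued.v (((((m : ↥(unitaryGroupOfForm (conjLocal L (IsCMField.complexConj L) v) (cmLocalForm L 3 v))) : GL (Fin 3) (LocalRing L v)) : Matrix (Fin 3) (Fin 3) (LocalRing L v)) 0 1) w) ≤ WithZero.exp ((j : ℤ) - ν)},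
          (fun n : ↥(cmBorelTriple L 3 v).N =>
            if h : IsUnit ((((n : ↥(unitaryGroupOfForm (conjLocal L (IsCMField.complexConj L) v) (cmLocalForm L 3 v))) : GL (Fin 3) (LocalRing L v)) : Matrix (Fin 3) (Fin 3) (LocalRing L v)) 0 2) then
              ((((χ₁ (Units.map ((conjLocal L (IsCMField.complexConj L) v) : LocalRing L v →* LocalRing L v) h.unit))⁻¹ : ℂˣ) : ℂ) *
                ((((unitModulusChar (LocalRing L v) h.unit)⁻¹ : ℝ≥0) : ℝ) : ℂ))
            else 0) n ∂μ =
          C * ((χ₁ (Units.map (conjLocal L (IsCMField.complexConj L) v : LocalRing L v →* LocalRing L v) piU * piU) : ℂˣ) : ℂ) ^ (κ + 1)) ∧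
      C ^ 2 * ((χ₁ (Units.map (conjLocal L (IsCMField.complexConj L) v : LocalRing L v →* LocalRing L v) piU * piU) : ℂˣ) : ℂ) =
        (((Ideal.absNorm w.1.asIdeal : ℝ) : ℂ) ^ ν *
          ((μ.real {m : ↥(cmBorelTriple L 3 v).N | Valued.v (((((m : ↥(unitaryGroupOfForm (conjLocal L (IsCMField.complexConj L) v) (cmLocalForm L 3 v))) : GL (Fin 3) (LocalRing L v)) : Matrix (Fin 3) (Fin 3) (LocalRing L v)) 0 2) w) ≤ Valued.v ϖ ^ (0 : ℕ) ∧
            Valued.v (((((m : ↥(unitaryGroupOfForm (conjLocal L (IsCMField.complexConj L) v) (cmLocalForm L 3 v))) : GL (Fin 3) (LocalRing L v)) : Matrix (Fin 3) (Fin 3) (LocalRing L v)) 0 1) w) ≤ Valued.v ϖ ^ ν} : ℝ) : ℂ)) ^ 2 *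
        ((((Ideal.absNorm w.1.asIdeal : ℝ) : ℂ) - 1) ^ 2 * ((((Ideal.absNorm w.1.asIdeal : ℝ) : ℂ)) ^ (2 * ν + 1))⁻¹)) :
    ∀ (w : PlacesOver L v) (hw : IsCMField.complexConj L • w.1 = w.1)
      (_he : v.asIdeal.ramificationIdx' w.1.asIdeal ≠ 1) (_h2w : Valued.v (2 : w.1.adicCompletion L) = 1)
      (eA : Gqs L v ≃ₜ* ↥(unitaryGroupOfForm (galAdicCompletionMap (L := L) (IsCMField.complexConj L) hw) ((StdForm.antidiagonal 3).over (w.1.adicCompletion L))))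
      (_heA : ∀ g : Gqs L v,
        ((eA g : ↥(unitaryGroupOfForm (galAdicCompletionMap (L := L) (IsCMField.complexConj L) hw) ((StdForm.antidiagonal 3).over (w.1.adicCompletion L)))) :
            GL (Fin 3) (w.1.adicCompletion L)) =
          ((localNonsplitEquiv (IsCMField.complexConj L) (qsForm L) (IsCMField.complexConj_ne_one L) w hw g :
            ↥(unitaryGroupOfForm (galAdicCompletionMap (L := L) (IsCMField.complexConj L) hw) (placeForm (qsForm L) w.1))) : GL (Fin 3) (w.1.adicCompletion L)))
      (ϖ : w.1.adicCompletion L) (_hϖ : Valued.v ϖ = WithZero.exp (-1 : ℤ))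
      (piU : (LocalRing L v)ˣ) (_hpiU : ∀ w' : PlacesOver L v, Valued.v ((piU : LocalRing L v) w') = WithZero.exp (-1 : ℤ))
      (g₁ : GL (Fin 3) (w.1.adicCompletion L)) (_hg₁ : (g₁ : Matrix (Fin 3) (Fin 3) (w.1.adicCompletion L)) = Matrix.diagonal ![(1 : w.1.adicCompletion L), 1, ϖ])
      (K0 K1 I : Subgroup (Gqs L v))
      (_hK0 : K0 = ((glInt 3 (w.1.adicCompletion L)).subgroupOf
        (unitaryGroupOfForm (galAdicCompletionMap (L := L) (IsCMField.complexConj L) hw) ((StdForm.antidiagonal 3).over (w.1.adicCompletion L)))).comap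
          eA.toMulEquiv.toMonoidHom)
      (_hK1 : K1 = (((glInt 3 (w.1.adicCompletion L)).map (MulAut.conj g₁).toMonoidHom).subgroupOf
        (unitaryGroupOfForm (galAdicCompletionMap (L := L) (IsCMField.complexConj L) hw) ((StdForm.antidiagonal 3).over (w.1.adicCompletion L)))).comap
          eA.toMulEquiv.toMonoidHom)
      (_hI : I = K0 ⊓ K1)
      (m : ℕ) (_hm : 1 ≤ m)
      (_hcond : ∀ u : (LocalRing L v)ˣ, (∀ w' : PlacesOver L v, Valued.v (((u : LocalRing L v) w') - 1) ≤ Valued.v ϖ ^ (m + 1)) → χ₁ u = 1)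
      (u₁ : (LocalRing L v)ˣ) (_hu₁ : ∀ w' : PlacesOver L v, Valued.v (((u₁ : LocalRing L v) w') - 1) ≤ Valued.v ϖ ^ m) (_hχu₁ : χ₁ u₁ ≠ 1)
      (ν : ℕ) (_hνν : ν + ν = m + 1)
      (Jg : Subgroup ↥(unitaryGroupOfForm (galAdicCompletionMap (L := L) (IsCMField.complexConj L) hw) ((StdForm.antidiagonal 3).over (w.1.adicCompletion L))))
      (_hJg : ∀ k : ↥(unitaryGroupOfForm (galAdicCompletionMap (L := L) (IsCMField.complexConj L) hw) ((StdForm.antidiagonal 3).over (w.1.adicCompletion L))),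
        k ∈ Jg ↔ ∀ i j, Valued.v (((k : GL (Fin 3) (w.1.adicCompletion L)) : Matrix (Fin 3) (Fin 3) (w.1.adicCompletion L)) i j) ≤
          Valued.v ϖ ^ (![![0, ν, 0], ![ν, 0, ν], ![1, ν, 0]] : Fin 3 → Fin 3 → ℕ) i j)
      (Je : Subgroup (Gqs L v)) (_hJe : Je = Jg.comap eA.toMulEquiv.toMonoidHom)
      (w₀ : ↥(unitaryGroupOfForm (conjLocal L (IsCMField.complexConj L) v) (cmLocalForm L 3 v))) (_hw₀ : Units.val (w₀ : GL (Fin 3) (LocalRing L v)) = cmLocalForm L 3 v)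
      [MeasurableSpace ↥(cmBorelTriple L 3 v).N] [BorelSpace ↥(cmBorelTriple L 3 v).N] (μ : Measure ↥(cmBorelTriple L 3 v).N) [μ.IsHaarMeasure]
      (f₁ f_w : haveI := locallyCompactSpace_cmBorelU L 3 v
        Representation.SmoothInd (cmBorelTriple L 3 v).P
          (Representation.twist (((Representation.trivial ℂ ↥(torusU (conjLocal L (IsCMField.complexConj L) v) (cmLocalForm L 3 v)) ℂ).twist
            (cmTorusCharPair L v χ₁ 1)).comp (cmBorelTriple L 3 v).proj) (rootDeltaChar (cmBorelTriple L 3 v).P))),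
      (∀ x ∈ Je, (haveI := locallyCompactSpace_cmBorelU L 3 v; Representation.smoothIndRep _ _ x f₁) =
        (if h : IsUnit (((x.val : GL (Fin 3) (LocalRing L v)) : Matrix (Fin 3) (Fin 3) (LocalRing L v)) 0 0) then ((χ₁ h.unit : ℂˣ) : ℂ) else 0) • f₁) →
      (∀ x ∈ Je, (haveI := locallyCompactSpace_cmBorelU L 3 v; Representation.smoothIndRep _ _ x f_w) =
        (if h : IsUnit (((x.val : GL (Fin 3) (LocalRing L v)) : Matrix (Fin 3) (Fin 3) (LocalRing L v)) 0 0) then ((χ₁ h.unit : ℂˣ) : ℂ) else 0) • f_w) →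
      f₁.toFun 1 = 1 → f₁.toFun w₀ = 0 → f_w.toFun 1 = 0 → f_w.toFun w₀ = 1 →
      ∃ V₁ V₂ : ℂ, V₁ ≠ 0 ∧ V₂ ≠ 0 ∧
        Integrable (fun n : ↥(cmBorelTriple L 3 v).N => f₁.toFun (w₀ * (n : ↥(unitaryGroupOfForm (conjLocal L (IsCMField.complexConj L) v) (cmLocalForm L 3 v))) * 1)) μ ∧
        Integrable (fun n : ↥(cmBorelTriple L 3 v).N => f_w.toFun (w₀ * (n : ↥(unitaryGroupOfForm (conjLocal L (IsCMField.complexConj L) v) (cmLocalForm L 3 v))) * 1)) μ ∧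
        Integrable (fun n : ↥(cmBorelTriple L 3 v).N => f₁.toFun (w₀ * (n : ↥(unitaryGroupOfForm (conjLocal L (IsCMField.complexConj L) v) (cmLocalForm L 3 v))) * w₀)) μ ∧
        Integrable (fun n : ↥(cmBorelTriple L 3 v).N => f_w.toFun (w₀ * (n : ↥(unitaryGroupOfForm (conjLocal L (IsCMField.complexConj L) v) (cmLocalForm L 3 v))) * w₀)) μ ∧
        ∫ n : ↥(cmBorelTriple L 3 v).N, f_w.toFun (w₀ * (n : ↥(unitaryGroupOfForm (conjLocal L (IsCMField.complexConj L) v) (cmLocalForm L 3 v))) * 1) ∂μ =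
          (((Ideal.absNorm w.1.asIdeal : ℝ) : ℂ) ^ ν)⁻¹ * V₂ ∧
        ∫ n : ↥(cmBorelTriple L 3 v).N, f₁.toFun (w₀ * (n : ↥(unitaryGroupOfForm (conjLocal L (IsCMField.complexConj L) v) (cmLocalForm L 3 v))) * w₀) ∂μ =
          (((Ideal.absNorm w.1.asIdeal : ℝ) : ℂ) ^ ν)⁻¹ * V₁ ∧
        ((∫ n : ↥(cmBorelTriple L 3 v).N, f₁.toFun (w₀ * (n : ↥(unitaryGroupOfForm (conjLocal L (IsCMField.complexConj L) v) (cmLocalForm L 3 v))) * 1) ∂μ = 0 ∧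
            ∫ n : ↥(cmBorelTriple L 3 v).N, f_w.toFun (w₀ * (n : ↥(unitaryGroupOfForm (conjLocal L (IsCMField.complexConj L) v) (cmLocalForm L 3 v))) * w₀) ∂μ = 0) ∨
          ((∃ a : (LocalRing L v)ˣ, Units.map (conjLocal L (IsCMField.complexConj L) v : LocalRing L v →* LocalRing L v) a = a ∧
              (∀ w' : PlacesOver L v, Valued.v ((a : LocalRing L v) w') = 1) ∧ χ₁ a ≠ 1) ∧
            ∃ Γ : ℂ, Γ ^ 2 * ((χ₁ (Units.map (conjLocal L (IsCMField.complexConj L) v : LocalRing L v →* LocalRing L v) piU * piU) : ℂˣ) : ℂ) =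
                (((Ideal.absNorm w.1.asIdeal : ℝ) : ℂ) - 1) ^ 2 * ((((Ideal.absNorm w.1.asIdeal : ℝ) : ℂ)) ^ (2 * ν + 1))⁻¹ ∧
              ∫ n : ↥(cmBorelTriple L 3 v).N, f₁.toFun (w₀ * (n : ↥(unitaryGroupOfForm (conjLocal L (IsCMField.complexConj L) v) (cmLocalForm L 3 v))) * 1) ∂μ =
                V₁ * (Γ * ((χ₁ (Units.map (conjLocal L (IsCMField.complexConj L) v : LocalRing L v →* LocalRing L v) piU * piU) : ℂˣ) : ℂ) /
                  (1 - ((χ₁ (Units.map (conjLocal L (IsCMField.complexConj L) v : LocalRing L v →* LocalRing L v) piU * piU) : ℂˣ) : ℂ))) ∧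
              ∫ n : ↥(cmBorelTriple L 3 v).N, f_w.toFun (w₀ * (n : ↥(unitaryGroupOfForm (conjLocal L (IsCMField.complexConj L) v) (cmLocalForm L 3 v))) * w₀) ∂μ =
                V₂ * (Γ * ((χ₁ (Units.map (conjLocal L (IsCMField.complexConj L) v : LocalRing L v →* LocalRing L v) piU * piU) : ℂˣ) : ℂ) /
                  (1 - ((χ₁ (Units.map (conjLocal L (IsCMField.complexConj L) v : LocalRing L v →* LocalRing L v) piU * piU) : ℂˣ) : ℂ))))) := by
  intro w hw he h2w eA heA ϖ hϖ piU hpiU g₁ hg₁ K0 K1 I hK0 hK1 hI m hm hcond u₁ hu₁ hχu₁ ν hνν Jg hJg Je hJe w₀ hw₀ _ _ μ _ f₁ f_w heig₁ heig_w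
    h11 h1g hw1 hwg
  haveI := locallyCompactSpace_cmBorelU L 3 v
  have hν : 1 ≤ ν := by omega
  -- the shell family `R` of ★ (B-2b″) and its ramified witness letter ★ (B-10)(2)
  obtain ⟨R, hR⟩ : ∃ R : Set ↥(unitaryGroupOfForm (conjLocal L (IsCMField.complexConj L) v) (cmLocalForm L 3 v)), ∀ r, r ∈ R ↔
      r ∈ ((cmBorelTriple L 3 v).N).map (MulAut.conj w₀).toMonoidHom ∧ r ∉ Je ∧
        ¬ (Valued.v ((((eA r : ↥(unitaryGroupOfForm (galAdicCompletionMap (L := L) (IsCMField.complexConj L) hw) ((StdForm.antidiagonal 3).over (w.1.adicCompletion L)))) : GL (Fin 3) (w.1.adicCompletion L)) : Matrix (Fin 3) (Fin 3) (w.1.adicCompletion L)) 2 1 /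
              (((eA r : ↥(unitaryGroupOfForm (galAdicCompletionMap (L := L) (IsCMField.complexConj L) hw) ((StdForm.antidiagonal 3).over (w.1.adicCompletion L)))) : GL (Fin 3) (w.1.adicCompletion L)) : Matrix (Fin 3) (Fin 3) (w.1.adicCompletion L)) 2 0) ≤ Valued.v ϖ ^ ν ∧
            (Valued.v ϖ ^ 0)⁻¹ ≤ Valued.v ((((eA r : ↥(unitaryGroupOfForm (galAdicCompletionMap (L := L) (IsCMField.complexConj L) hw) ((StdForm.antidiagonal 3).over (w.1.adicCompletion L)))) : GL (Fin 3) (w.1.adicCompletion L)) : Matrix (Fin 3) (Fin 3) (w.1.adicCompletion L)) 2 0)) :=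
    ⟨{r | _}, fun _ => Iff.rfl⟩
  have hwit := BposRamCellCoverTwoDepthKZeroCM.cells_witness_kZero_ram L v w hw eA heA hϖ ν ν Jg hJg Je hJe w₀ hw₀ R hR hm hνν le_rfl (Nat.le_succ ν)
    he h2w χ₁ hcontr hcond u₁ hu₁ hχu₁
  -- the four integrands as indicators (★ FILE B at `r₁ = r₂ = ν`)
  have hI11 := fun n : ↥(cmBorelTriple L 3 v).N =>
    BposPairIntegrandsTwoDepth.toFun_weyl_mul_eq_indicator_cutoff L v w hw eA heA hϖ ν ν Jg hJg Je hJe w₀ hw₀ χ₁ f₁ heig₁ R hR hwit h11 h1g n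
  have hIww := fun n : ↥(cmBorelTriple L 3 v).N =>
    BposPairIntegrandsTwoDepth.toFun_conj_weyl_eq_indicator_cutoff L v w hw eA heA ν ν Jg hJg Je hJe w₀ hw₀ χ₁ f_w heig_w R hR hwit hw1 hwg n
  have hIw1 := fun n : ↥(cmBorelTriple L 3 v).N =>
    BposPairIntegrandsTwoDepth.toFun_weyl_mul_eq_indicator_box L v w hw eA heA ν ν Jg hJg Je hJe w₀ hw₀ χ₁ f_w heig_w R hR hwit hw1 hwg n
  have hI1w := fun n : ↥(cmBorelTriple L 3 v).N =>
    BposPairIntegrandsTwoDepth.toFun_conj_weyl_eq_indicator_box L v w hw eA heA hϖ ν ν Jg hJg Je hJe w₀ hw₀ χ₁ f₁ heig₁ R hR hwit h11 h1g n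
  -- the cut shells are Borel (★ (B)); `F₀` is integrable on the two cut-offs `C(ν, 1), C(ν, 0) ⊆ {|z| ≥ 1}` (★); `|X| < 1` (★)
  have hmeas := BposRamCutoffShells.measurableSet_shell_cut L v w hw
  have hSge := K2E3BranchBShellScalingFromWeightSeries.integrableOn_F₀_S_ge L v w hw hns χ₁ h₁ hcontr μ
  have hF1 := hSge.mono_set (BposPairIntegrandsTwoDepth.cutoff_subset_setOf_one_le_v L v w (ϖ := ϖ) ν (j₀ := ((1 : ℕ) : ℤ)) (by norm_num))
  have hF0 := hSge.mono_set (BposPairIntegrandsTwoDepth.cutoff_subset_setOf_one_le_v L v w (ϖ := ϖ) ν (j₀ := ((0 : ℕ) : ℤ)) le_rfl)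
  have hX := norm_apply_norm_uniformizer_lt_one L v hns w hw piU hpiU χ₁ hcontr
  by_cases hFε : ∃ a : (LocalRing L v)ˣ, Units.map (conjLocal L (IsCMField.complexConj L) v : LocalRing L v →* LocalRing L v) a = a ∧
      (∀ w' : PlacesOver L v, Valued.v ((a : LocalRing L v) w') = 1) ∧ χ₁ a ≠ 1
  · -- sub-branch (R-b): the parity law `HRb`, the two cut-off values by ★ (6c), then ★ (8⁺a)
    obtain ⟨heven, C, hodd, hC2⟩ := HRb w hw he h2w hϖ piU hpiU hm hνν hcond u₁ hu₁ hχu₁ μ hFε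
    have hcut1 := BposRamMasterIntegral.setIntegral_cutoff_eq_of_even_odd_shells L v w μ hϖ hmeas _ ν 1 le_rfl hF1 C _ hX
      (fun j hj hej => heven 1 j hj hej) hodd
    have hcut0 := BposRamMasterIntegral.setIntegral_cutoff_eq_of_even_odd_shells L v w μ hϖ hmeas _ ν 0 (Nat.zero_le _) hF0 C _ hX
      (fun j hj hej => heven 0 j hj hej) hodd
    exact BposRamPairEntriesOfShells.HEram_body_of_cutoffs L v w hw hns he h2w hϖ piU χ₁ h₁ hcontr hν w₀ μ f₁ f_w hI11 hIww hIw1 hI1w hmeas C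
      hcut1 hcut0 (Or.inr ⟨hFε, hC2⟩)
  · -- sub-branch (R-a): `χ₁ = 1` on the σ-fixed units of valuation one; every shell vanishes (`HRa`), cut-off values with `C := 0`, then ★ (8⁺a)
    have hRa0 : ∀ a : (LocalRing L v)ˣ, Units.map (conjLocal L (IsCMField.complexConj L) v : LocalRing L v →* LocalRing L v) a = a →
        (∀ w' : PlacesOver L v, Valued.v ((a : LocalRing L v) w') = 1) → χ₁ a = 1 := fun a ha hav => by
      by_contra h
      exact hFε ⟨a, ha, hav, h⟩
    obtain ⟨heven, hodd0⟩ := HRa w hw he h2w hϖ piU hpiU hm hνν hcond u₁ hu₁ hχu₁ μ hRa0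
    have hcut1 := BposRamMasterIntegral.setIntegral_cutoff_eq_of_even_odd_shells L v w μ hϖ hmeas _ ν 1 le_rfl hF1 0 _ hX
      (fun j hj hej => heven 1 j hj hej) (fun j κ hj => by rw [zero_mul]; exact hodd0 j κ hj)
    have hcut0 := BposRamMasterIntegral.setIntegral_cutoff_eq_of_even_odd_shells L v w μ hϖ hmeas _ ν 0 (Nat.zero_le _) hF0 0 _ hX
      (fun j hj hej => heven 0 j hj hej) (fun j κ hj => by rw [zero_mul]; exact hodd0 j κ hj)
    exact BposRamPairEntriesOfShells.HEram_body_of_cutoffs L v w hw hns he h2w hϖ piU χ₁ h₁ hcontr hν w₀ μ f₁ f_w hI11 hIww hIw1 hI1w hmeas 0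
      hcut1 hcut0 (Or.inl rfl)

end KeysThmTwoPosDepthBranchBRamifiedTameLeafOfRecord

/-! ## §2 The (S-RT) head of U4Keys :182 at a tamely ramified place, modulo `HRa` ∕ `HRb` -/

open Classical in
set_option maxHeartbeats 4000000 in
set_option synthInstance.maxHeartbeats 400000 in
-- the letters' `F₀`-dites and GL-coercion chains (class of ★ (8) §2)
/-- **U4Keys :182 IN BRANCH B AT POSITIVE DEPTH, TAMELY RAMIFIED PLACE — THE (S-RT) HEAD MODULO THE TWO SHELL LETTERS.**  `v` non-split (`hns`) and RAMIFIED in `L` (`hrf`), TAME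
(`h2`: `|2|_{w′} = 1`); `χ₁ : (L ⊗ L⁺_v)ˣ → ℂˣ` continuous (`h₁`), non-unitary (`hnu`), contracting (`hcontr`), ramified (`hram`, idle), of positive depth (`hpos`), with `χ₁(u·σu) = 1`
on the units of valuation one (`hB`, Branch B); the two shell letters `HRa` ((R-a): all cut shells of `F₀` vanish) and `HRb` ((R-b): even shells vanish, odd shells `C·X^{κ+1}`,
`C²·X = (q^ν·μ B(ν,0))²·((q−1)²·(q^{2ν+1})⁻¹)` — ★ (6d-R)'s conclusion bytes); if `i(χ₁, 1)` is reducible (`hred`) then **`χ₁ = η·‖·‖^{1∕2}` for a continuous quadratic character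
extension `η`** — DISJUNCT 2 of :182.  One term: ★ (8) `…_of_pairEntries` with `HEram := §1 HEram_of_layers … HRa HRb`. [cite: Keys1984, §3, §7 Theorem (2) (b)–(d) p. 126]
[cite: Casselman1980, §3] [cite: Roche1998, §3–§4] [cite: Rogawski1990, §12.2 (1)–(2) p. 173] -/
theorem exists_eta_of_reducible_posDepth_normTrivial_ramifiedTame
    (hns : ∀ w' : PlacesOver L v, IsCMField.complexConj L • w'.1 = w'.1)
    (hrf : ¬ Algebra.IsUnramifiedIn (𝓞 L) v.asIdeal)
    (h2 : ∀ w' : PlacesOver L v, Valued.v (2 : w'.1.adicCompletion L) = 1)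
    (χ₁ : (LocalRing L v)ˣ →* ℂˣ) (h₁ : Continuous fun x => ((χ₁ x : ℂˣ) : ℂ)) (hnu : ∃ x, ‖((χ₁ x : ℂˣ) : ℂ)‖ ≠ 1)
    (hcontr : ∀ x : (LocalRing L v)ˣ, unitModulusChar (LocalRing L v) x < 1 → ‖((χ₁ x : ℂˣ) : ℂ)‖ < 1)
    (_hram : ¬ (∀ u ∈ (Submonoid.pi Set.univ (fun w : PlacesOver L v => (w.1.adicCompletionIntegers L).toSubring.toSubmonoid)).units, χ₁ u = 1))
    (hpos : ∃ u : (LocalRing L v)ˣ, (∀ w' : PlacesOver L v, Valued.v (((u : LocalRing L v) w') - 1) < 1) ∧ χ₁ u ≠ 1)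
    (hB : ∀ u : (LocalRing L v)ˣ, (∀ w' : PlacesOver L v, Valued.v ((u : LocalRing L v) w') = 1) →
      χ₁ (u * Units.map (conjLocal L (IsCMField.complexConj L) v : LocalRing L v →* LocalRing L v) u) = 1)
    (HRa : ∀ (w : PlacesOver L v) (hw : IsCMField.complexConj L • w.1 = w.1)
      (_he : v.asIdeal.ramificationIdx' w.1.asIdeal ≠ 1) (_h2w : Valued.v (2 : w.1.adicCompletion L) = 1)
      {ϖ : w.1.adicCompletion L} (_hϖ : Valued.v ϖ = WithZero.exp (-1 : ℤ))
      (piU : (LocalRing L v)ˣ) (_hpiU : ∀ w' : PlacesOver L v, Valued.v ((piU : LocalRing L v) w') = WithZero.exp (-1 : ℤ))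
      {m ν : ℕ} (_hm : 1 ≤ m) (_hνν : ν + ν = m + 1)
      (_hcond : ∀ u : (LocalRing L v)ˣ, (∀ w' : PlacesOver L v, Valued.v (((u : LocalRing L v) w') - 1) ≤ Valued.v ϖ ^ (m + 1)) → χ₁ u = 1)
      (u₁ : (LocalRing L v)ˣ) (_hu₁ : ∀ w' : PlacesOver L v, Valued.v (((u₁ : LocalRing L v) w') - 1) ≤ Valued.v ϖ ^ m) (_hχu₁ : χ₁ u₁ ≠ 1)
      [MeasurableSpace ↥(cmBorelTriple L 3 v).N] [BorelSpace ↥(cmBorelTriple L 3 v).N] (μ : Measure ↥(cmBorelTriple L 3 v).N) [μ.IsHaarMeasure],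
      (∀ a : (LocalRing L v)ˣ, Units.map (conjLocal L (IsCMField.complexConj L) v : LocalRing L v →* LocalRing L v) a = a →
          (∀ w' : PlacesOver L v, Valued.v ((a : LocalRing L v) w') = 1) → χ₁ a = 1) →
    (∀ j₀ j : ℕ, j₀ ≤ j → Even j → ∫ n in {m : ↥(cmBorelTriple L 3 v).N |
        Valued.v (((((m : ↥(unitaryGroupOfForm (conjLocal L (IsCMField.complexConj L) v) (cmLocalForm L 3 v))) : GL (Fin 3) (LocalRing L v)) : Matrix (Fin 3) (Fin 3) (LocalRing L v)) 0 2) w) = WithZero.exp (j : ℤ) ∧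
        Valued.v (((((m : ↥(unitaryGroupOfForm (conjLocal L (IsCMField.complexConj L) v) (cmLocalForm L 3 v))) : GL (Fin 3) (LocalRing L v)) : Matrix (Fin 3) (Fin 3) (LocalRing L v)) 0 1) w) ≤ WithZero.exp ((j : ℤ) - ν)},
        (fun n : ↥(cmBorelTriple L 3 v).N =>
          if h : IsUnit ((((n : ↥(unitaryGroupOfForm (conjLocal L (IsCMField.complexConj L) v) (cmLocalForm L 3 v))) : GL (Fin 3) (LocalRing L v)) : Matrix (Fin 3) (Fin 3) (LocalRing L v)) 0 2) then
            ((((χ₁ (Units.map ((conjLocal L (IsCMField.complexConj L) v) : LocalRing L v →* LocalRing L v) h.unit))⁻¹ : ℂˣ) : ℂ) *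
              ((((unitModulusChar (LocalRing L v) h.unit)⁻¹ : ℝ≥0) : ℝ) : ℂ))
          else 0) n ∂μ = 0) ∧
      (∀ j κ : ℕ, j = 2 * κ + 1 → ∫ n in {m : ↥(cmBorelTriple L 3 v).N |
          Valued.v (((((m : ↥(unitaryGroupOfForm (conjLocal L (IsCMField.complexConj L) v) (cmLocalForm L 3 v))) : GL (Fin 3) (LocalRing L v)) : Matrix (Fin 3) (Fin 3) (LocalRing L v)) 0 2) w) = WithZero.exp (j : ℤ) ∧
          Valued.v (((((m : ↥(unitaryGroupOfForm (conjLocal L (IsCMField.complexConj L) v) (cmLocalForm L 3 v))) : GL (Fin 3) (LocalRing L v)) : Matrix (Fin 3) (Fin 3) (LocalRing L v)) 0 1) w) ≤ WithZero.exp ((j : ℤ) - ν)},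
          (fun n : ↥(cmBorelTriple L 3 v).N =>
            if h : IsUnit ((((n : ↥(unitaryGroupOfForm (conjLocal L (IsCMField.complexConj L) v) (cmLocalForm L 3 v))) : GL (Fin 3) (LocalRing L v)) : Matrix (Fin 3) (Fin 3) (LocalRing L v)) 0 2) then
              ((((χ₁ (Units.map ((conjLocal L (IsCMField.complexConj L) v) : LocalRing L v →* LocalRing L v) h.unit))⁻¹ : ℂˣ) : ℂ) *
                ((((unitModulusChar (LocalRing L v) h.unit)⁻¹ : ℝ≥0) : ℝ) : ℂ))
            else 0) n ∂μ = 0))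
    (HRb : ∀ (w : PlacesOver L v) (hw : IsCMField.complexConj L • w.1 = w.1)
      (_he : v.asIdeal.ramificationIdx' w.1.asIdeal ≠ 1) (_h2w : Valued.v (2 : w.1.adicCompletion L) = 1)
      {ϖ : w.1.adicCompletion L} (_hϖ : Valued.v ϖ = WithZero.exp (-1 : ℤ))
      (piU : (LocalRing L v)ˣ) (_hpiU : ∀ w' : PlacesOver L v, Valued.v ((piU : LocalRing L v) w') = WithZero.exp (-1 : ℤ))
      {m ν : ℕ} (_hm : 1 ≤ m) (_hνν : ν + ν = m + 1)
      (_hcond : ∀ u : (LocalRing L v)ˣ, (∀ w' : PlacesOver L v, Valued.v (((u : LocalRing L v) w') - 1) ≤ Valued.v ϖ ^ (m + 1)) → χ₁ u = 1)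
      (u₁ : (LocalRing L v)ˣ) (_hu₁ : ∀ w' : PlacesOver L v, Valued.v (((u₁ : LocalRing L v) w') - 1) ≤ Valued.v ϖ ^ m) (_hχu₁ : χ₁ u₁ ≠ 1)
      [MeasurableSpace ↥(cmBorelTriple L 3 v).N] [BorelSpace ↥(cmBorelTriple L 3 v).N] (μ : Measure ↥(cmBorelTriple L 3 v).N) [μ.IsHaarMeasure],
      (∃ a : (LocalRing L v)ˣ, Units.map (conjLocal L (IsCMField.complexConj L) v : LocalRing L v →* LocalRing L v) a = a ∧
          (∀ w' : PlacesOver L v, Valued.v ((a : LocalRing L v) w') = 1) ∧ χ₁ a ≠ 1) →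
    (∀ j₀ j : ℕ, j₀ ≤ j → Even j → ∫ n in {m : ↥(cmBorelTriple L 3 v).N |
        Valued.v (((((m : ↥(unitaryGroupOfForm (conjLocal L (IsCMField.complexConj L) v) (cmLocalForm L 3 v))) : GL (Fin 3) (LocalRing L v)) : Matrix (Fin 3) (Fin 3) (LocalRing L v)) 0 2) w) = WithZero.exp (j : ℤ) ∧
        Valued.v (((((m : ↥(unitaryGroupOfForm (conjLocal L (IsCMField.complexConj L) v) (cmLocalForm L 3 v))) : GL (Fin 3) (LocalRing L v)) : Matrix (Fin 3) (Fin 3) (LocalRing L v)) 0 1) w) ≤ WithZero.exp ((j : ℤ) - ν)},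
        (fun n : ↥(cmBorelTriple L 3 v).N =>
          if h : IsUnit ((((n : ↥(unitaryGroupOfForm (conjLocal L (IsCMField.complexConj L) v) (cmLocalForm L 3 v))) : GL (Fin 3) (LocalRing L v)) : Matrix (Fin 3) (Fin 3) (LocalRing L v)) 0 2) then
            ((((χ₁ (Units.map ((conjLocal L (IsCMField.complexConj L) v) : LocalRing L v →* LocalRing L v) h.unit))⁻¹ : ℂˣ) : ℂ) *
              ((((unitModulusChar (LocalRing L v) h.unit)⁻¹ : ℝ≥0) : ℝ) : ℂ))
          else 0) n ∂μ = 0) ∧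
    ∃ C : ℂ,
      (∀ j κ : ℕ, j = 2 * κ + 1 → ∫ n in {m : ↥(cmBorelTriple L 3 v).N |
          Valued.v (((((m : ↥(unitaryGroupOfForm (conjLocal L (IsCMField.complexConj L) v) (cmLocalForm L 3 v))) : GL (Fin 3) (LocalRing L v)) : Matrix (Fin 3) (Fin 3) (LocalRing L v)) 0 2) w) = WithZero.exp (j : ℤ) ∧
          Valued.v (((((m : ↥(unitaryGroupOfForm (conjLocal L (IsCMField.complexConj L) v) (cmLocalForm L 3 v))) : GL (Fin 3) (LocalRing L v)) : Matrix (Fin 3) (Fin 3) (LocalRing L v)) 0 1) w) ≤ WithZero.exp ((j : ℤ) - ν)},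
          (fun n : ↥(cmBorelTriple L 3 v).N =>
            if h : IsUnit ((((n : ↥(unitaryGroupOfForm (conjLocal L (IsCMField.complexConj L) v) (cmLocalForm L 3 v))) : GL (Fin 3) (LocalRing L v)) : Matrix (Fin 3) (Fin 3) (LocalRing L v)) 0 2) then
              ((((χ₁ (Units.map ((conjLocal L (IsCMField.complexConj L) v) : LocalRing L v →* LocalRing L v) h.unit))⁻¹ : ℂˣ) : ℂ) *
                ((((unitModulusChar (LocalRing L v) h.unit)⁻¹ : ℝ≥0) : ℝ) : ℂ))
            else 0) n ∂μ =
          C * ((χ₁ (Units.map (conjLocal L (IsCMField.complexConj L) v : LocalRing L v →* LocalRing L v) piU * piU) : ℂˣ) : ℂ) ^ (κ + 1)) ∧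
      C ^ 2 * ((χ₁ (Units.map (conjLocal L (IsCMField.complexConj L) v : LocalRing L v →* LocalRing L v) piU * piU) : ℂˣ) : ℂ) =
        (((Ideal.absNorm w.1.asIdeal : ℝ) : ℂ) ^ ν *
          ((μ.real {m : ↥(cmBorelTriple L 3 v).N | Valued.v (((((m : ↥(unitaryGroupOfForm (conjLocal L (IsCMField.complexConj L) v) (cmLocalForm L 3 v))) : GL (Fin 3) (LocalRing L v)) : Matrix (Fin 3) (Fin 3) (LocalRing L v)) 0 2) w) ≤ Valued.v ϖ ^ (0 : ℕ) ∧
            Valued.v (((((m : ↥(unitaryGroupOfForm (conjLocal L (IsCMField.complexConj L) v) (cmLocalForm L 3 v))) : GL (Fin 3) (LocalRing L v)) : Matrix (Fin 3) (Fin 3) (LocalRing L v)) 0 1) w) ≤ Valued.v ϖ ^ ν} : ℝ) : ℂ)) ^ 2 *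
        ((((Ideal.absNorm w.1.asIdeal : ℝ) : ℂ) - 1) ^ 2 * ((((Ideal.absNorm w.1.asIdeal : ℝ) : ℂ)) ^ (2 * ν + 1))⁻¹))
    (hred : ∃ N : Subrepresentation (cmPrincipalSeries L 3 v (cmTorusCharPair L v χ₁ 1)), N ≠ ⊥ ∧ N ≠ ⊤) :
    ∃ η : (LocalRing L v)ˣ →* ℂˣ, IsQuadraticCharExtension (conjLocal L (IsCMField.complexConj L) v) η ∧
      Continuous (fun x => ((η x : ℂˣ) : ℂ)) ∧ χ₁ = η * halfModulusChar (LocalRing L v) :=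
  KeysThmTwoPosDepthBranchBRamifiedTameLeaf.exists_eta_of_reducible_posDepth_normTrivial_ramifiedTame_of_pairEntries L v hns hrf h2 χ₁ h₁ hnu hcontr hpos hB
    (KeysThmTwoPosDepthBranchBRamifiedTameLeafOfRecord.HEram_of_layers L v hns χ₁ h₁ hcontr HRa HRb) hred

end Summit.HodgeConjecture.HodgeConjecture.R90.S1

end
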